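import Summits.NavierStokesRegularity.NavierStokesRegularity.Theses.PalasekTowerBreakdown
import Summits.NavierStokesRegularity.FluidComputer.PalasekTowerHandoverPressureRate
import Summits.NavierStokesRegularity.FluidComputer.PalasekTowerOvershootPressureRate
import Summits.NavierStokesRegularity.FluidComputer.PalasekTowerRegisterGlobalEnvelopeAtHolds
import Summits.NavierStokesRegularity.FluidComputer.PalasekTowerSpeedMaximum

/-!
# Route `PalasekTowerBreakdown`: the HAND-OVER PRESSURE RATE every witness of the cruxes carries, and the
# child cruxes from «pressure push slower than the overshoot line ∧ floors» — by name

Cell `ns-blowup`, seat `ns-blowup-fc-prover-3` (g3; prover). Support file for the cruxes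
`PalasekTowerBreakdown.HeredityAtOne` (item stmt-NavierStokesRegularity-19249),
`PalasekTowerBreakdown.HeredityFromTwo` (-19250), `PalasekTowerBreakdown.EpisodeInduction` (-19178) and
`PalasekTowerBreakdown.EpisodeBase` (-19179) of the route — SUPPORTS only, nothing claimed or closed.
LABEL: E–C typing (KERNEL: compositions of this seat's landed FluidComputer theorems
`PalasekTowerHandoverPressureRate.lean` / `PalasekTowerOvershootPressureRate.lean` (the RATE form of
first hitting) with the route decls BY NAME; no new mathematics, no named fact). WHAT THIS IS NOT: not
Navier–Stokes evidence — the cruxes are OPEN; the statements below are necessary conditions on their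
witnesses, and sufficient conditions for two of them in terms of OPEN rate bounds; nothing is
constructed or asserted.

* `palasekTowerBreakdown_heredityAtOne_pressureRate` — ANY proof of `HeredityAtOne` delivers, for every
  pinned rigid quiet wide schedule and every registered level-1 stage, a level-2 extension whose silent
  hand-over `1 → 2` achieves the MEAN RATE by pressure alone at some instant: `t⋆ ∈ (τ₁, τ₂]` and a
  global argmax `x⋆` with speed in `(4630, 6140)`, exceeding all earlier speeds, where
  `|Du|²_F + 2.74·10⁷ ‖u‖ ≤ −⟪u, ∇p⟫`, so `‖∇p(t⋆, x⋆)‖ ≥ 2.74·10⁷` and `−⟪u, ∇p⟫(t⋆, x⋆) > 1.26·10¹¹`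
  (`Stage.exists_firstSilentWindow_pressureRate`, unconditional in the extension); general slopes:
  `palasekTowerBreakdown_heredityAtOne_pressureRate_slope`.
* `palasekTowerBreakdown_episodeInduction_pressureRate` — the same at every hand-over `k → k+1`,
  `k ≥ 1`, every admissible slope, for the extensions delivered by `EpisodeInduction`.
* `palasekTowerBreakdown_episodeBase_firstWindow_pressureRate` — ANY witness of `EpisodeBase` (a
  registered level-1 stage) shows in its FORCED window `0 → 1` an instant and a global argmax with
  speed in `(1351, 2779)` where the pressure gradient accelerates the fluid at rate `≥ μ` for every
  `0 ≤ μ ≤ 6.99·10⁶` (the force supplies at most `1/8` of the mean rate under `Pins 8`).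
* `palasekTowerBreakdown_heredityAtOne_of_pressureRate_floors` /
  `…_of_pressureRate_num_floors` / `palasekTowerBreakdown_heredityFromTwo_of_pressureRate_floors` — the
  child cruxes BY NAME from the RATE bound on the pressure push at running speed maxima in the band
  `(c₂ Y_k, c₂ Y_{k+1}]` (`aprioriCeilingAt_of_pressureRate`, `aprioriCeiling_of_pressureRate`) and the
  readout floors; strictly weaker hypotheses than g2's sign-condition versions (p442066 / p442483).

* (g3 append 2) `…_not_heredityAtOne_of_slowPressure_slope`, `…_not_heredityAtOne_of_gradPressure_le`.
* (g3 append) `palasekTowerBreakdown_readoutFloorsAt_one_pressureRate` (the LOWER stub's rate reading on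
  every continuation), `palasekTowerBreakdown_not_heredityAtOne_of_slowPressure` (refutation template, rate
  form), `palasekTowerBreakdown_heredityAtOne_iSup_path` (continuous max path of every witness, IVT).

References: S. Palasek, arXiv:2605.13827 §3.3, §4 [cite: Palasek2026ElementaryModel, §4].
-/

-- `Summit.<Summit>.<Problem>` is the tree's mandated summit-side namespace (CONVENTIONS §2); for this
-- single-conjunct summit the two coincide, so the duplicate is deliberate.
set_option linter.dupNamespace false

noncomputable section

namespace Summit.NavierStokesRegularity.NavierStokesRegularity.Theorems

open Set MeasureTheory Filter Topology Function Real
open scoped ENNReal ContDiff NNReal InnerProductSpace RealInnerProductSpace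
open Summit.NavierStokesRegularity.NavierStokesRegularity.Theses
open Summit.NavierStokesRegularity.FluidComputer.PalasekTowerClayBridge
open Literature.Analysis.FluidPDE

/-! ## §1 Necessary: the hand-over pressure rate of every witness -/

/-- **The hand-over pressure rate of every witness of `HeredityAtOne` (number of record).** If the child
crux holds, then for every pinned (`Λ = 8`, `θ = 6/5`), rigid, quiet schedule on the wide-base rates and
every globally anchored registered level-1 stage `s` there is a level-2 stage `s'` extending it whose
silent hand-over `1 → 2` is PRESSURE-DRIVEN AT THE MEAN RATE at some instant: `∃ t⋆ ∈ (τ₁, τ₂], ∃ x⋆`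
with `4630 < ‖s'.u t⋆ x⋆‖ < 6140` the global speed maximum at `t⋆`, larger than every earlier speed,
`|Du|²_F + 2.74·10⁷ · ‖u‖ ≤ −⟪u, ∇p⟫` at `(t⋆, x⋆)` (unit viscosity), hence `‖∇p(t⋆, x⋆)‖ ≥ 2.74·10⁷`
and `−⟪u, ∇p⟫(t⋆, x⋆) > 1.26·10¹¹`. Unconditional in `s'`; conditional only on the crux producing `s'`.
[cite: Palasek2026ElementaryModel, §4] -/
theorem palasekTowerBreakdown_heredityAtOne_pressureRate (h : PalasekTowerBreakdown.HeredityAtOne) :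
    ∀ S : Schedule TowerRates.wide, S.Pins 8 (6 / 5) → S.Rigid → S.Quiet →
      ∀ s : Stage 1 TowerRates.wide S (Margins.routeG TowerRates.wide) 1,
        ∃ s' : Stage 1 TowerRates.wide S (Margins.routeG TowerRates.wide) 2, s.Extends s' ∧
          ∃ t₀ ∈ Ioc (S.τ 1) (S.τ 2), ∃ x₀ : EuclideanSpace ℝ (Fin 3),
            4630 < ‖s'.u t₀ x₀‖ ∧ ‖s'.u t₀ x₀‖ < 6140 ∧
            (∀ x, ‖s'.u t₀ x‖ ≤ ‖s'.u t₀ x₀‖) ∧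
            (∀ t ∈ Ico 0 t₀, ∀ x, ‖s'.u t x‖ < ‖s'.u t₀ x₀‖) ∧
            1 * frobeniusNormSq (fderiv ℝ (s'.u t₀) x₀) + 27400000 * ‖s'.u t₀ x₀‖ ≤
              - ⟪s'.u t₀ x₀, gradient (s'.p t₀) x₀⟫ ∧
            27400000 ≤ ‖gradient (s'.p t₀) x₀‖ ∧
            126000000000 < - ⟪s'.u t₀ x₀, gradient (s'.p t₀) x₀⟫ := by
  intro S hP hR hQ s
  obtain ⟨s', hs'⟩ := h S hP hR hQ s
  exact ⟨s', hs', s'.exists_firstSilentWindow_pressureRate one_pos hR hQ le_rfl⟩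

/-- **The hand-over pressure rate of every witness of `HeredityAtOne`, every admissible slope.** For
every slope `0 ≤ Λ` with `Λ (τ₂ − τ₁) < c₁ Y₂ − c₂ Y₁` (every `Λ ≤ 2.74·10⁷` qualifies,
`Schedule.Rigid.handoverRate_one_bounds`) the level-2 extension delivered by the crux has an instant
`t⋆ ∈ (τ₁, τ₂]` and a global argmax with speed `c₁ Y₂ − Λ (τ₂ − t⋆) ∈ (c₂ Y₁, c₁ Y₂]`, larger than every
earlier speed, rising at rate `≥ Λ` into `t⋆`, where `|Du|²_F + Λ‖u‖ ≤ −⟪u, ∇p⟫` and `‖∇p‖ ≥ Λ`.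
[cite: Palasek2026ElementaryModel, §4] -/
theorem palasekTowerBreakdown_heredityAtOne_pressureRate_slope (h : PalasekTowerBreakdown.HeredityAtOne)
    {Λ : ℝ} (hΛ0 : 0 ≤ Λ) :
    ∀ S : Schedule TowerRates.wide, S.Pins 8 (6 / 5) → S.Rigid → S.Quiet →
      Λ * (S.τ 2 - S.τ 1) < S.c₁ * TowerRates.wide.Y 2 - S.c₂ * TowerRates.wide.Y 1 →
      ∀ s : Stage 1 TowerRates.wide S (Margins.routeG TowerRates.wide) 1,
        ∃ s' : Stage 1 TowerRates.wide S (Margins.routeG TowerRates.wide) 2, s.Extends s' ∧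
          ∃ t₀ ∈ Ioc (S.τ 1) (S.τ 2), ∃ x₀ : EuclideanSpace ℝ (Fin 3),
            ‖s'.u t₀ x₀‖ = S.c₁ * TowerRates.wide.Y 2 - Λ * (S.τ 2 - t₀) ∧
            S.c₂ * TowerRates.wide.Y 1 < ‖s'.u t₀ x₀‖ ∧ ‖s'.u t₀ x₀‖ ≤ S.c₁ * TowerRates.wide.Y 2 ∧
            (∀ x, ‖s'.u t₀ x‖ ≤ ‖s'.u t₀ x₀‖) ∧
            (∀ t ∈ Ico 0 t₀, ∀ x, ‖s'.u t x‖ < ‖s'.u t₀ x₀‖) ∧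
            Λ * ‖s'.u t₀ x₀‖ ≤ ⟪s'.u t₀ x₀, timeDerivWithin (Icc 0 (S.τ 2)) s'.u t₀ x₀⟫ ∧
            1 * frobeniusNormSq (fderiv ℝ (s'.u t₀) x₀) + Λ * ‖s'.u t₀ x₀‖ ≤
              - ⟪s'.u t₀ x₀, gradient (s'.p t₀) x₀⟫ ∧
            Λ ≤ ‖gradient (s'.p t₀) x₀‖ := by
  intro S hP hR hQ hΛ s
  obtain ⟨s', hs'⟩ := h S hP hR hQ s
  exact ⟨s', hs', s'.exists_window_pressureRate_quiet one_pos hQ (j := 1) le_rfl le_rfl hΛ0 hΛ⟩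

/-- **The hand-over pressure rate of every witness of `EpisodeInduction`** (the parent crux, item
stmt-NavierStokesRegularity-19178): for every `k ≥ 1`, the level-`(k+1)` extension delivered by the crux
and every slope `0 ≤ Λ` with `Λ (τ_{k+1} − τ_k) < c₁ Y_{k+1} − c₂ Y_k`: some `t⋆ ∈ (τ_k, τ_{k+1}]` and
global argmax with speed in `(c₂ Y_k, c₁ Y_{k+1}]`, larger than every earlier speed, where
`|Du|²_F + Λ‖u‖ ≤ −⟪u, ∇p⟫` and `‖∇p‖ ≥ Λ`. [cite: Palasek2026ElementaryModel, §4] -/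
theorem palasekTowerBreakdown_episodeInduction_pressureRate (h : PalasekTowerBreakdown.EpisodeInduction) :
    ∀ S : Schedule TowerRates.wide, S.Pins 8 (6 / 5) → S.Rigid → S.Quiet → ∀ k : ℕ, 1 ≤ k →
      ∀ s : Stage 1 TowerRates.wide S (Margins.routeG TowerRates.wide) k,
        ∃ s' : Stage 1 TowerRates.wide S (Margins.routeG TowerRates.wide) (k + 1), s.Extends s' ∧
          ∀ Λ : ℝ, 0 ≤ Λ →
            Λ * (S.τ (k + 1) - S.τ k) < S.c₁ * TowerRates.wide.Y (k + 1) - S.c₂ * TowerRates.wide.Y k →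
            ∃ t₀ ∈ Ioc (S.τ k) (S.τ (k + 1)), ∃ x₀ : EuclideanSpace ℝ (Fin 3),
              ‖s'.u t₀ x₀‖ = S.c₁ * TowerRates.wide.Y (k + 1) - Λ * (S.τ (k + 1) - t₀) ∧
              S.c₂ * TowerRates.wide.Y k < ‖s'.u t₀ x₀‖ ∧
              ‖s'.u t₀ x₀‖ ≤ S.c₁ * TowerRates.wide.Y (k + 1) ∧
              (∀ x, ‖s'.u t₀ x‖ ≤ ‖s'.u t₀ x₀‖) ∧
              (∀ t ∈ Ico 0 t₀, ∀ x, ‖s'.u t x‖ < ‖s'.u t₀ x₀‖) ∧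
              Λ * ‖s'.u t₀ x₀‖ ≤ ⟪s'.u t₀ x₀, timeDerivWithin (Icc 0 (S.τ (k + 1))) s'.u t₀ x₀⟫ ∧
              1 * frobeniusNormSq (fderiv ℝ (s'.u t₀) x₀) + Λ * ‖s'.u t₀ x₀‖ ≤
                - ⟪s'.u t₀ x₀, gradient (s'.p t₀) x₀⟫ ∧
              Λ ≤ ‖gradient (s'.p t₀) x₀‖ := by
  intro S hP hR hQ k hk s
  obtain ⟨s', hs'⟩ := h S hP hR hQ k hk s
  exact ⟨s', hs', fun Λ hΛ0 hΛ =>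
    s'.exists_window_pressureRate_quiet one_pos hQ (j := k) hk le_rfl hΛ0 hΛ⟩

/-- **The first window of every witness of `EpisodeBase`** (item stmt-NavierStokesRegularity-19179): any
registered level-1 stage of a pinned (`Λ₀ = 8`) rigid quiet wide schedule shows, in its FORCED window
`(τ₀, τ₁]`, for every rate `0 ≤ μ ≤ 6.99·10⁶`, an instant and a global argmax with speed in
`(1351, 2779)`, larger than every earlier speed, where the PRESSURE GRADIENT accelerates the fluid at
rate `≥ μ` against its own viscous rate: `|Du|²_F + μ‖u‖ ≤ −⟪u, ∇p⟫` (the window force supplies at most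
`1/8` of the mean growth rate `(Y₁ − Y₀)/(τ₁ − τ₀) ≈ 8.0·10⁶` of the global speed maximum). A necessary
condition on every host of the stub `first_episode`. [cite: Palasek2026ElementaryModel, §3.3] -/
theorem palasekTowerBreakdown_episodeBase_firstWindow_pressureRate (h : PalasekTowerBreakdown.EpisodeBase)
    {μ : ℝ} (hμ0 : 0 ≤ μ) (hμ : μ ≤ 6990000) :
    ∃ S : Schedule TowerRates.wide, S.Pins 8 (6 / 5) ∧ S.Rigid ∧ S.Quiet ∧
      ∃ s : Stage 1 TowerRates.wide S (Margins.routeG TowerRates.wide) 1,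
        ∃ t₀ ∈ Ioc (S.τ 0) (S.τ 1), ∃ x₀ : EuclideanSpace ℝ (Fin 3),
          1351 < ‖s.u t₀ x₀‖ ∧ ‖s.u t₀ x₀‖ < 2779 ∧
          (∀ x, ‖s.u t₀ x‖ ≤ ‖s.u t₀ x₀‖) ∧
          (∀ t ∈ Ico 0 t₀, ∀ x, ‖s.u t x‖ < ‖s.u t₀ x₀‖) ∧
          1 * frobeniusNormSq (fderiv ℝ (s.u t₀) x₀) + μ * ‖s.u t₀ x₀‖ ≤
            - ⟪s.u t₀ x₀, gradient (s.p t₀) x₀⟫ ∧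
          μ * 1351 ≤ - ⟪s.u t₀ x₀, gradient (s.p t₀) x₀⟫ := by
  obtain ⟨S, hP, hR, hQ, ⟨s⟩⟩ := h
  exact ⟨S, hP, hR, hQ, s, s.exists_firstWindow_pressureRate_wide one_pos hP hR le_rfl hμ0 hμ⟩

/-! ## §2 Sufficient: the child cruxes from a RATE bound on the pressure push and the floors -/

/-- **THE FIRST RUNG BY NAME FROM «slow pressure push ∧ floors».** Item stmt-NavierStokesRegularity-19249
`PalasekTowerBreakdown.HeredityAtOne` follows from: (i) the RATE BOUND «at every running global speed
maximum in the band `(c₂ Y₁, c₂ Y₂]` of every finite-energy classical continuation (before `τ₂`) of every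
registered level-1 stage, exceeding all earlier speeds, the velocity-projected pressure push is slower
than the overshoot line: `−⟪u, ∇p⟫ < |Du|²_F + c₂ (Y₂ − Y₁)/(τ₂ − τ₁) · ‖u‖`» — which gives
`AprioriCeilingAt 1` (this seat's `aprioriCeilingAt_of_pressureRate`; local continuation across `τ₁` is
the tree theorem after F2, ecbridge-7 `continuationEnvelopeAt_one_iff_aprioriCeilingAt_one`); (ii) the
readout floors at `τ₂` (`ReadoutFloorsAt 1`). Both hypotheses are OPEN; nothing is asserted.
[cite: Palasek2026ElementaryModel, §4] -/
theorem palasekTowerBreakdown_heredityAtOne_of_pressureRate_floors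
    (hPR : ∀ S : Schedule TowerRates.wide, S.Pins 8 (6 / 5) → S.Rigid → S.Quiet →
      ∀ s : Stage 1 TowerRates.wide S (Margins.routeG TowerRates.wide) 1,
      ∀ T' ∈ Icc (S.τ 1) (S.τ (1 + 1)),
      ∀ (u : ℝ → EuclideanSpace ℝ (Fin 3) → EuclideanSpace ℝ (Fin 3))
        (p : ℝ → EuclideanSpace ℝ (Fin 3) → ℝ),
        IsClassicalNSSolutionOn (Icc 0 T') 1 S.f u p →
        (∀ t ∈ Icc 0 (S.τ 1), u t = s.u t ∧ p t = s.p t) →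
        (∃ C : ℝ≥0∞, C < ⊤ ∧ ∀ t ∈ Icc 0 T', ∫⁻ x, ‖u t x‖ₑ ^ 2 ≤ C) →
        ∀ t ∈ Ioc (S.τ 1) T', ∀ x : EuclideanSpace ℝ (Fin 3),
          (∀ y, ‖u t y‖ ≤ ‖u t x‖) →
          S.c₂ * TowerRates.wide.Y 1 < ‖u t x‖ → ‖u t x‖ ≤ S.c₂ * TowerRates.wide.Y (1 + 1) →
          (∀ t' ∈ Ico 0 t, ∀ y, ‖u t' y‖ < ‖u t x‖) →
          - ⟪u t x, gradient (p t) x⟫ < frobeniusNormSq (fderiv ℝ (u t) x) +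
            (S.c₂ * TowerRates.wide.Y (1 + 1) - S.c₂ * TowerRates.wide.Y 1) / (S.τ (1 + 1) - S.τ 1) *
              ‖u t x‖)
    (hF : ReadoutFloorsAt 1) : PalasekTowerBreakdown.HeredityAtOne :=
  heredityAtOne_of_aprioriCeilingAt_readoutFloorsAt (aprioriCeilingAt_of_pressureRate le_rfl hPR) hF

/-- **The first rung BY NAME from the NUMERICAL rate bound `1.021·10⁸` and the floors**: if at every
running global speed maximum in the band `((5/3) Y₁, (5/3) Y₂]` (exceeding all earlier speeds) of every
finite-energy classical continuation of every registered level-1 stage the pressure push obeys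
`−⟪u, ∇p⟫ < |Du|²_F + 1.021·10⁸ · ‖u‖`, and `ReadoutFloorsAt 1`, then `PalasekTowerBreakdown.HeredityAtOne`.
[cite: Palasek2026ElementaryModel, §4] -/
theorem palasekTowerBreakdown_heredityAtOne_of_pressureRate_num_floors
    (hPR : ∀ S : Schedule TowerRates.wide, S.Pins 8 (6 / 5) → S.Rigid → S.Quiet →
      ∀ s : Stage 1 TowerRates.wide S (Margins.routeG TowerRates.wide) 1,
      ∀ T' ∈ Icc (S.τ 1) (S.τ 2),
      ∀ (u : ℝ → EuclideanSpace ℝ (Fin 3) → EuclideanSpace ℝ (Fin 3))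
        (p : ℝ → EuclideanSpace ℝ (Fin 3) → ℝ),
        IsClassicalNSSolutionOn (Icc 0 T') 1 S.f u p →
        (∀ t ∈ Icc 0 (S.τ 1), u t = s.u t ∧ p t = s.p t) →
        (∃ C : ℝ≥0∞, C < ⊤ ∧ ∀ t ∈ Icc 0 T', ∫⁻ x, ‖u t x‖ₑ ^ 2 ≤ C) →
        ∀ t ∈ Ioc (S.τ 1) T', ∀ x : EuclideanSpace ℝ (Fin 3),
          (∀ y, ‖u t y‖ ≤ ‖u t x‖) →
          S.c₂ * TowerRates.wide.Y 1 < ‖u t x‖ → ‖u t x‖ ≤ S.c₂ * TowerRates.wide.Y 2 →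
          (∀ t' ∈ Ico 0 t, ∀ y, ‖u t' y‖ < ‖u t x‖) →
          - ⟪u t x, gradient (p t) x⟫ < frobeniusNormSq (fderiv ℝ (u t) x) + 102100000 * ‖u t x‖)
    (hF : ReadoutFloorsAt 1) : PalasekTowerBreakdown.HeredityAtOne :=
  heredityAtOne_of_aprioriCeilingAt_readoutFloorsAt (aprioriCeilingAt_one_of_pressureRate_num hPR) hF

/-- **`HeredityFromTwo` BY NAME from «slow pressure push ∧ floors» at the generic levels.** Item
stmt-NavierStokesRegularity-19250 `PalasekTowerBreakdown.HeredityFromTwo` (= `HeredityFrom 2`) follows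
from the RATE BOUND at every running global speed maximum in the band `(c₂ Y_k, c₂ Y_{k+1}]` (`k ≥ 2`)
of every finite-energy classical continuation of every registered level-`k` stage —
`−⟪u, ∇p⟫ < |Du|²_F + c₂ (Y_{k+1} − Y_k)/(τ_{k+1} − τ_k) · ‖u‖`, which gives `AprioriCeiling` (this
seat's `aprioriCeiling_of_pressureRate`) — together with `ReadoutFloors`
(`heredityFrom_two_of_aprioriCeiling_floors`). Both hypotheses are OPEN; nothing is asserted.
[cite: Palasek2026ElementaryModel, §4] -/
theorem palasekTowerBreakdown_heredityFromTwo_of_pressureRate_floors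
    (hPR : ∀ S : Schedule TowerRates.wide, S.Pins 8 (6 / 5) → S.Rigid → S.Quiet → ∀ k : ℕ, 2 ≤ k →
      ∀ s : Stage 1 TowerRates.wide S (Margins.routeG TowerRates.wide) k,
      ∀ T' ∈ Icc (S.τ k) (S.τ (k + 1)),
      ∀ (u : ℝ → EuclideanSpace ℝ (Fin 3) → EuclideanSpace ℝ (Fin 3))
        (p : ℝ → EuclideanSpace ℝ (Fin 3) → ℝ),
        IsClassicalNSSolutionOn (Icc 0 T') 1 S.f u p →
        (∀ t ∈ Icc 0 (S.τ k), u t = s.u t ∧ p t = s.p t) →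
        (∃ C : ℝ≥0∞, C < ⊤ ∧ ∀ t ∈ Icc 0 T', ∫⁻ x, ‖u t x‖ₑ ^ 2 ≤ C) →
        ∀ t ∈ Ioc (S.τ k) T', ∀ x : EuclideanSpace ℝ (Fin 3),
          (∀ y, ‖u t y‖ ≤ ‖u t x‖) →
          S.c₂ * TowerRates.wide.Y k < ‖u t x‖ → ‖u t x‖ ≤ S.c₂ * TowerRates.wide.Y (k + 1) →
          (∀ t' ∈ Ico 0 t, ∀ y, ‖u t' y‖ < ‖u t x‖) →
          - ⟪u t x, gradient (p t) x⟫ < frobeniusNormSq (fderiv ℝ (u t) x) +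
            (S.c₂ * TowerRates.wide.Y (k + 1) - S.c₂ * TowerRates.wide.Y k) / (S.τ (k + 1) - S.τ k) *
              ‖u t x‖)
    (hF : ReadoutFloors) : PalasekTowerBreakdown.HeredityFromTwo :=
  heredityFrom_two_of_aprioriCeiling_floors (aprioriCeiling_of_pressureRate hPR) hF

/-! ## §3 (g3 append) The lower stub's rate reading, a refutation template, and the continuous path -/

/-- **The rate reading of the LOWER stub `ReadoutFloorsAt 1`.** If the readout floors hold at the first
rung, then EVERY finite-energy classical continuation `(u, p)` of a registered level-1 stage to `τ₂` inside
the ceiling `(5/3) Y₂` (the object the stub quantifies over) reaches the speed floor `c₁ Y₂` at `τ₂` from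
`≤ c₂ Y₁` at `τ₁`, so it crosses the mean-rate line: some `t⋆ ∈ (τ₁, τ₂]` and global argmax `x⋆` with
speed `c₁ Y₂ − 2.74·10⁷ (τ₂ − t⋆) ∈ (c₂ Y₁, c₁ Y₂]`, exceeding every earlier speed, where
`|Du|²_F + ⟪u, ∇p⟫ + 2.74·10⁷ ‖u‖ ≤ 0` (force silent; `Stage.exists_lineCrossing_continuation`,
`Schedule.Rigid.handoverRate_one_bounds`). A necessary condition the stub imposes on every continuation;
nothing is asserted. [cite: Palasek2026ElementaryModel, §4] -/
theorem palasekTowerBreakdown_readoutFloorsAt_one_pressureRate (hF : ReadoutFloorsAt 1) :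
    ∀ S : Schedule TowerRates.wide, S.Pins 8 (6 / 5) → S.Rigid → S.Quiet →
      ∀ s : Stage 1 TowerRates.wide S (Margins.routeG TowerRates.wide) 1,
      ∀ (u : ℝ → EuclideanSpace ℝ (Fin 3) → EuclideanSpace ℝ (Fin 3))
        (p : ℝ → EuclideanSpace ℝ (Fin 3) → ℝ),
        IsClassicalNSSolutionOn (Icc 0 (S.τ 2)) 1 S.f u p →
        (∀ t ∈ Icc 0 (S.τ 1), u t = s.u t ∧ p t = s.p t) →
        (∃ C : ℝ≥0∞, C < ⊤ ∧ ∀ t ∈ Icc 0 (S.τ 2), ∫⁻ x, ‖u t x‖ₑ ^ 2 ≤ C) →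
        (∀ t ∈ Icc 0 (S.τ 2), ∀ x, ‖u t x‖ ≤ S.c₂ * TowerRates.wide.Y 2) →
        ∃ t₀ ∈ Ioc (S.τ 1) (S.τ 2), ∃ x₀ : EuclideanSpace ℝ (Fin 3),
          ‖u t₀ x₀‖ = S.c₁ * TowerRates.wide.Y 2 - 27400000 * (S.τ 2 - t₀) ∧
          (∀ x, ‖u t₀ x‖ ≤ ‖u t₀ x₀‖) ∧
          27400000 * ‖u t₀ x₀‖ ≤ ⟪u t₀ x₀, timeDerivWithin (Icc 0 (S.τ 2)) u t₀ x₀⟫ ∧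
          1 * frobeniusNormSq (fderiv ℝ (u t₀) x₀) + ⟪u t₀ x₀, gradient (p t₀) x₀⟫ +
            27400000 * ‖u t₀ x₀‖ ≤ 0 := by
  intro S hP hR hQ s u p hcl hagree henergy hceil
  obtain ⟨⟨x, -, hx⟩, -, -⟩ := hF S hP hR hQ s u p hcl hagree henergy hceil
  obtain ⟨hrate, -⟩ := hR.handoverRate_one_bounds
  have hw : 0 < S.τ 2 - S.τ 1 := by linarith [S.τ_lt_succ 1]
  have hΛ : (27400000 : ℝ) * (S.τ 2 - S.τ 1) <
      S.c₁ * TowerRates.wide.Y 2 - S.c₂ * TowerRates.wide.Y 1 := (lt_div_iff₀ hw).1 hrate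
  have hB : 0 < S.c₁ * TowerRates.wide.Y 2 :=
    mul_pos S.c₁_pos (Real.rpow_pos_of_pos (TowerRates.wide.N_pos 2) _)
  have hT₂ : S.τ 2 ∈ Icc (S.τ 1) (S.τ 2) := ⟨(S.τ_lt_succ 1).le, le_rfl⟩
  obtain ⟨t₀, ht₀, x₀, hval, hmax, -, htime, hineq⟩ :=
    s.exists_lineCrossing_continuation one_pos hQ le_rfl (S.τ_lt_succ 1).le hcl
      (fun t ht => (hagree t ht).1) henergy hB hT₂ ⟨x, hx⟩ hΛ
  exact ⟨t₀, ht₀, x₀, hval, hmax, htime, hineq⟩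

/-- **REFUTATION TEMPLATE (rate form).** To refute item stmt-NavierStokesRegularity-19249
`PalasekTowerBreakdown.HeredityAtOne` it suffices to exhibit ONE pinned (`Λ = 8`, `θ = 6/5`) rigid quiet wide
schedule and ONE registered level-1 stage `s` such that EVERY level-2 stage `s'` extending `s` (there is at
most one continuation, `Stage.continuation_velocity_eq`) has, at every `t ∈ (τ₁, τ₂]` and every global argmax
`x` with speed in the band `(c₂ Y₁, c₁ Y₂]` exceeding all earlier speeds, a pressure push SLOWER than the mean
rate: `−⟪u, ∇p⟫ < |Du|²_F + 2.74·10⁷ ‖u‖`. (Contrapositive of `Stage.exists_window_pressureRate_quiet` at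
slope `2.74·10⁷`.) Vacuity warning: no registered level-1 stage is known (`EpisodeBaseG` open).
[cite: Palasek2026ElementaryModel, §4] -/
theorem palasekTowerBreakdown_not_heredityAtOne_of_slowPressure (S : Schedule TowerRates.wide)
    (hP : S.Pins 8 (6 / 5)) (hR : S.Rigid) (hQ : S.Quiet)
    (s : Stage 1 TowerRates.wide S (Margins.routeG TowerRates.wide) 1)
    (h : ∀ s' : Stage 1 TowerRates.wide S (Margins.routeG TowerRates.wide) 2, s.Extends s' →
      ∀ t ∈ Ioc (S.τ 1) (S.τ 2), ∀ x : EuclideanSpace ℝ (Fin 3),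
        (∀ y, ‖s'.u t y‖ ≤ ‖s'.u t x‖) →
        S.c₂ * TowerRates.wide.Y 1 < ‖s'.u t x‖ → ‖s'.u t x‖ ≤ S.c₁ * TowerRates.wide.Y 2 →
        (∀ t' ∈ Ico 0 t, ∀ y, ‖s'.u t' y‖ < ‖s'.u t x‖) →
        - ⟪s'.u t x, gradient (s'.p t) x⟫ <
          1 * frobeniusNormSq (fderiv ℝ (s'.u t) x) + 27400000 * ‖s'.u t x‖) :
    ¬ PalasekTowerBreakdown.HeredityAtOne := by
  intro hH
  obtain ⟨s', hs'⟩ := hH S hP hR hQ s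
  obtain ⟨hrate, -⟩ := hR.handoverRate_one_bounds
  have hw : 0 < S.τ 2 - S.τ 1 := by linarith [S.τ_lt_succ 1]
  have hΛ : (27400000 : ℝ) * (S.τ (1 + 1) - S.τ 1) <
      S.c₁ * TowerRates.wide.Y (1 + 1) - S.c₂ * TowerRates.wide.Y 1 := by
    rw [show (1 : ℕ) + 1 = 2 from rfl]; exact (lt_div_iff₀ hw).1 hrate
  obtain ⟨t₀, ht₀, x₀, -, hlow, hupp, hmax, hstrict, -, hPr, -⟩ :=
    s'.exists_window_pressureRate_quiet one_pos hQ (j := 1) le_rfl le_rfl (by norm_num) hΛ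
  rw [show (1 : ℕ) + 1 = 2 from rfl] at ht₀ hupp
  have hlt := h s' hs' t₀ ht₀ x₀ hmax hlow hupp hstrict
  linarith

/-- **The continuous path of every witness of `HeredityAtOne`.** The level-2 extension `s'` delivered by the
crux has a CONTINUOUS global speed maximum `t ↦ ⨆ x, ‖s'.u t x‖` on `[0, τ₂]` (p448304
`Stage.continuousOn_iSup_norm`), which is `≤ c₂ Y₁` at `τ₁`, `≥ c₁ Y₂` at `τ₂`, and takes EVERY value
`L ∈ [c₂ Y₁, c₁ Y₂] = [(5/3) Y₁, Y₂] ⊂ (4630, 6140)` at some instant of `[τ₁, τ₂]`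
(`Stage.exists_iSup_norm_eq_of_mem_Icc`). [cite: Palasek2026ElementaryModel, §4] -/
theorem palasekTowerBreakdown_heredityAtOne_iSup_path (h : PalasekTowerBreakdown.HeredityAtOne) :
    ∀ S : Schedule TowerRates.wide, S.Pins 8 (6 / 5) → S.Rigid → S.Quiet →
      ∀ s : Stage 1 TowerRates.wide S (Margins.routeG TowerRates.wide) 1,
        ∃ s' : Stage 1 TowerRates.wide S (Margins.routeG TowerRates.wide) 2, s.Extends s' ∧
          ContinuousOn (fun t => ⨆ x, ‖s'.u t x‖) (Icc 0 (S.τ 2)) ∧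
          (⨆ x, ‖s'.u (S.τ 1) x‖) ≤ S.c₂ * TowerRates.wide.Y 1 ∧
          S.c₁ * TowerRates.wide.Y 2 ≤ (⨆ x, ‖s'.u (S.τ 2) x‖) ∧
          ∀ L ∈ Icc (S.c₂ * TowerRates.wide.Y 1) (S.c₁ * TowerRates.wide.Y 2),
            ∃ t ∈ Icc (S.τ 1) (S.τ 2), (⨆ x, ‖s'.u t x‖) = L := by
  intro S hP hR hQ s
  obtain ⟨s', hs'⟩ := h S hP hR hQ s
  refine ⟨s', hs', s'.continuousOn_iSup_norm one_pos,
    s'.iSup_norm_le_ceiling (j := 1) (by norm_num) ⟨(S.τ_pos 1).le, le_rfl⟩,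
    s'.floor_le_iSup_norm one_pos (j := 2) le_rfl, fun L hL => ?_⟩
  exact s'.exists_iSup_norm_eq_of_mem_Icc one_pos (j := 1) le_rfl hL

/-! ## §4 (g3 append 2) Refutation templates at a general slope and from a pressure-gradient cap -/

/-- **REFUTATION TEMPLATE, general slope** `0 ≤ Λ`, `Λ (τ₂ − τ₁) < c₁ Y₂ − c₂ Y₁`: one registered
level-1 stage all of whose level-2 extensions push slower than `|Du|²_F + Λ‖u‖` at running maxima in the
band refutes `PalasekTowerBreakdown.HeredityAtOne`. Vacuity warning. [cite: Palasek2026ElementaryModel, §4] -/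
theorem palasekTowerBreakdown_not_heredityAtOne_of_slowPressure_slope (S : Schedule TowerRates.wide)
    (hP : S.Pins 8 (6 / 5)) (hR : S.Rigid) (hQ : S.Quiet)
    (s : Stage 1 TowerRates.wide S (Margins.routeG TowerRates.wide) 1) {Λ : ℝ} (hΛ0 : 0 ≤ Λ)
    (hΛ : Λ * (S.τ 2 - S.τ 1) < S.c₁ * TowerRates.wide.Y 2 - S.c₂ * TowerRates.wide.Y 1)
    (h : ∀ s' : Stage 1 TowerRates.wide S (Margins.routeG TowerRates.wide) 2, s.Extends s' →
      ∀ t ∈ Ioc (S.τ 1) (S.τ 2), ∀ x : EuclideanSpace ℝ (Fin 3),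
        (∀ y, ‖s'.u t y‖ ≤ ‖s'.u t x‖) →
        S.c₂ * TowerRates.wide.Y 1 < ‖s'.u t x‖ → ‖s'.u t x‖ ≤ S.c₁ * TowerRates.wide.Y 2 →
        (∀ t' ∈ Ico 0 t, ∀ y, ‖s'.u t' y‖ < ‖s'.u t x‖) →
        - ⟪s'.u t x, gradient (s'.p t) x⟫ <
          1 * frobeniusNormSq (fderiv ℝ (s'.u t) x) + Λ * ‖s'.u t x‖) :
    ¬ PalasekTowerBreakdown.HeredityAtOne := by
  intro hH
  obtain ⟨s', hs'⟩ := hH S hP hR hQ s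
  have hΛ' : Λ * (S.τ (1 + 1) - S.τ 1) <
      S.c₁ * TowerRates.wide.Y (1 + 1) - S.c₂ * TowerRates.wide.Y 1 := by
    rw [show (1 : ℕ) + 1 = 2 from rfl]; exact hΛ
  obtain ⟨t₀, ht₀, x₀, -, hlow, hupp, hmax, hstrict, -, hPr, -⟩ :=
    s'.exists_window_pressureRate_quiet one_pos hQ (j := 1) le_rfl le_rfl hΛ0 hΛ'
  rw [show (1 : ℕ) + 1 = 2 from rfl] at ht₀ hupp
  have hlt := h s' hs' t₀ ht₀ x₀ hmax hlow hupp hstrict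
  linarith

/-- **REFUTATION TEMPLATE from a PRESSURE-GRADIENT CAP** (quantitative-cap route, pressure form): one
registered level-1 stage all of whose level-2 extensions obey `‖∇p‖ ≤ P` at running global maxima in the
band `(c₂ Y₁, c₁ Y₂]` during `(τ₁, τ₂]`, with `0 ≤ P`, `P (τ₂ − τ₁) < c₁ Y₂ − c₂ Y₁` (every `P ≤ 2.74·10⁷`),
refutes `PalasekTowerBreakdown.HeredityAtOne` (speed limit). Vacuity warning. [cite: Palasek2026ElementaryModel, §4] -/
theorem palasekTowerBreakdown_not_heredityAtOne_of_gradPressure_le (S : Schedule TowerRates.wide)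
    (hP : S.Pins 8 (6 / 5)) (hR : S.Rigid) (hQ : S.Quiet)
    (s : Stage 1 TowerRates.wide S (Margins.routeG TowerRates.wide) 1) {P : ℝ} (hP0 : 0 ≤ P)
    (hPw : P * (S.τ 2 - S.τ 1) < S.c₁ * TowerRates.wide.Y 2 - S.c₂ * TowerRates.wide.Y 1)
    (h : ∀ s' : Stage 1 TowerRates.wide S (Margins.routeG TowerRates.wide) 2, s.Extends s' →
      ∀ t ∈ Ioc (S.τ 1) (S.τ 2), ∀ x : EuclideanSpace ℝ (Fin 3),
        (∀ y, ‖s'.u t y‖ ≤ ‖s'.u t x‖) →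
        S.c₂ * TowerRates.wide.Y 1 < ‖s'.u t x‖ → ‖s'.u t x‖ ≤ S.c₁ * TowerRates.wide.Y 2 →
        (∀ t' ∈ Ico 0 t, ∀ y, ‖s'.u t' y‖ < ‖s'.u t x‖) →
        ‖gradient (s'.p t) x‖ ≤ P) :
    ¬ PalasekTowerBreakdown.HeredityAtOne := by
  have hw : 0 < S.τ 2 - S.τ 1 := by linarith [S.τ_lt_succ 1]
  obtain ⟨Λ, hPΛ, hΛm⟩ := exists_between ((lt_div_iff₀ hw).2 hPw :
    P < (S.c₁ * TowerRates.wide.Y 2 - S.c₂ * TowerRates.wide.Y 1) / (S.τ 2 - S.τ 1))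
  have hΛ0 : 0 ≤ Λ := hP0.trans hPΛ.le
  have hΛ : Λ * (S.τ 2 - S.τ 1) < S.c₁ * TowerRates.wide.Y 2 - S.c₂ * TowerRates.wide.Y 1 :=
    (lt_div_iff₀ hw).1 hΛm
  refine palasekTowerBreakdown_not_heredityAtOne_of_slowPressure_slope S hP hR hQ s hΛ0 hΛ ?_
  intro s' hs' t ht x hmax hlow hupp hstrict
  have hg := h s' hs' t ht x hmax hlow hupp hstrict
  have hpos : 0 < ‖s'.u t x‖ :=
    lt_trans (mul_pos s'.c₂_pos (Real.rpow_pos_of_pos (TowerRates.wide.N_pos 1) _)) hlow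
  have hCS : - ⟪s'.u t x, gradient (s'.p t) x⟫ ≤ ‖s'.u t x‖ * ‖gradient (s'.p t) x‖ := by
    linarith [abs_real_inner_le_norm (s'.u t x) (gradient (s'.p t) x),
      neg_abs_le ⟪s'.u t x, gradient (s'.p t) x⟫]
  have hF : 0 ≤ 1 * frobeniusNormSq (fderiv ℝ (s'.u t) x) := by
    rw [one_mul]; exact frobeniusNormSq_nonneg _
  have h1 : ‖s'.u t x‖ * ‖gradient (s'.p t) x‖ ≤ ‖s'.u t x‖ * P :=
    mul_le_mul_of_nonneg_left hg (norm_nonneg _)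
  have h2 : ‖s'.u t x‖ * P < ‖s'.u t x‖ * Λ := mul_lt_mul_of_pos_left hPΛ hpos
  linarith

end Summit.NavierStokesRegularity.NavierStokesRegularity.Theorems

end
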